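import Mathlib
import Summits.CriticalPhenomena.CardyFormulaZ2.Theorems.CardyMagicRigidityMagicFormulaTUVNegligible
import HarnessLib

/-!
# `MagicFormulaT` ⟸ its big-loop (truncated) form — sorry-free reduction (crux `MagicFormulaT`, line `Sketch` v6)

Crux `Summit.CriticalPhenomena.CardyFormulaZ2.Theses.CardyMagicRigidity.MagicFormulaT`
(stmt-CriticalPhenomena-4836), line `Sketch`, skeleton v6 (the UV split).  With the UV theorem landed
(`smallLoops_negligible_site`, `…MagicFormulaTUVNegligible`), the crux is EQUIVALENT to its truncated form, and
this file records the useful direction as a sorry-free theorem between statements (registered sub-goal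
`magicFormulaT_of_bigLoopsMagicT`):

**Theorem.** If for every admissible `f` and `κ > 0`, for all small cut-offs `η` and then all small meshes,
`|Λ^{𝕋,≥η}_δ(f) − exp((3/4π²)∬ log‖x−y‖ f f)| ≤ κ` (the transform truncated to the loops of trace-diameter
`≥ η`), then `MagicFormulaT`.

So a continuum line (Camia–Newman full-plane CLE₆ + truncated transfer + all-order Gaussianity of the twisted
nesting field of CLE₆) only has to reach the TRUNCATED statement: the lattice UV bookkeeping is done.  Proof:
`3ε` through `integral_site_eq` (the crux's expectation is `truncNestingTransform … f 0`).
-/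

noncomputable section

namespace Summit.CriticalPhenomena.CardyFormulaZ2.Cruxes.MagicFormulaT.LineSketch

open MeasureTheory Filter Set
open scoped Real Topology BigOperators
open Literature.Probability.RandomPlanarGeometry Literature.Probability.Percolation
  Literature.Probability.LatticeModels

/-- **`MagicFormulaT` from its big-loop form** (registered sub-goal `magicFormulaT_of_bigLoopsMagicT`): the
truncated magic formula on `𝕋` — for every admissible `f` and `κ > 0`, eventually in the cut-off and then in the
mesh, `|Λ^{𝕋,≥η}_δ(f) − Gaussian(f)| ≤ κ` — implies the crux, by the landed UV theorem
`smallLoops_negligible_site` and a `3ε` argument. -/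
theorem magicFormulaT_of_bigLoopsMagicT :
    (∀ (f : ℂ → ℝ) (R C : ℝ), Measurable f → (∀ z, |f z| ≤ C) → (∀ z, R < ‖z‖ → f z = 0) →
      ∫ z, f z = 0 → ∀ κ : ℝ, 0 < κ → ∀ᶠ η in 𝓝[>] (0 : ℝ), ∀ᶠ δ in 𝓝[>] (0 : ℝ),
        |truncNestingTransform (triSitePercolation half) (siteLoopConfig δ) f η -
          Real.exp (3 / (4 * π ^ 2) * ∫ x, ∫ y, Real.log ‖x - y‖ * f x * f y)| ≤ κ) →
    Summit.CriticalPhenomena.CardyFormulaZ2.Theses.CardyMagicRigidity.MagicFormulaT := by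
  intro hIR f R C hf hC hR h0
  -- the statement for the truncated transform at cut-off `0`
  have key : Tendsto (fun δ : ℝ ↦ truncNestingTransform (triSitePercolation half) (siteLoopConfig δ) f 0)
      (𝓝[>] 0) (𝓝 (Real.exp (3 / (4 * π ^ 2) * ∫ x, ∫ y, Real.log ‖x - y‖ * f x * f y))) := by
    rw [Metric.tendsto_nhds]
    intro ε hε
    have hε3 : 0 < ε / 3 := by positivity
    have hU := smallLoops_negligible_site f R C hf hC hR h0 (ε / 3) hε3
    have hI := hIR f R C hf hC hR h0 (ε / 3) hε3
    obtain ⟨η, hηU, hηI⟩ := (hU.and hI).exists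
    filter_upwards [hηU, hηI] with δ h1 h2
    rw [Real.dist_eq]
    calc |truncNestingTransform (triSitePercolation half) (siteLoopConfig δ) f 0 -
            Real.exp (3 / (4 * π ^ 2) * ∫ x, ∫ y, Real.log ‖x - y‖ * f x * f y)|
          = |(truncNestingTransform (triSitePercolation half) (siteLoopConfig δ) f 0 -
                truncNestingTransform (triSitePercolation half) (siteLoopConfig δ) f η) +
              (truncNestingTransform (triSitePercolation half) (siteLoopConfig δ) f η -
                Real.exp (3 / (4 * π ^ 2) * ∫ x, ∫ y, Real.log ‖x - y‖ * f x * f y))| := by ring_nf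
      _ ≤ |truncNestingTransform (triSitePercolation half) (siteLoopConfig δ) f 0 -
              truncNestingTransform (triSitePercolation half) (siteLoopConfig δ) f η| +
            |truncNestingTransform (triSitePercolation half) (siteLoopConfig δ) f η -
              Real.exp (3 / (4 * π ^ 2) * ∫ x, ∫ y, Real.log ‖x - y‖ * f x * f y)| := abs_add_le _ _
      _ ≤ ε / 3 + ε / 3 := add_le_add h1 h2
      _ < ε := by linarith
  -- transfer to the literal expectation of the crux (`integral_site_eq`)
  refine key.congr' (Eventually.of_forall fun δ ↦ ?_)
  exact (Theorems.integral_site_eq f δ).symm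

end Summit.CriticalPhenomena.CardyFormulaZ2.Cruxes.MagicFormulaT.LineSketch

end
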